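import Mathlib
import Summits.NavierStokesRegularity.NavierStokesRegularity.Theorems.EulerZoomLiouvillePowerGaugeEulerLiouvilleWindowFluxBounds
import Summits.NavierStokesRegularity.NavierStokesRegularity.Theorems.EulerZoomLiouvillePowerGaugeEulerLiouvilleFromRest
import HarnessLib

/-!
# WINDOW FLUX INTEGRABILITY from the gauges and «NO EULER COLLAPSE FROM REST» for `2/5 < ρ`
# (crux `EulerZoomLiouville.PowerGaugeEulerLiouville` = stmt-NavierStokesRegularity-19832, lead's line `birth`)

Route `EulerZoomLiouville` (NavierStokesRegularity).  The crux E: an ancient suitable weak Euler flow on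
`(−∞,0) × ℝ³` in Seregin's power-gauged class `a^{2ρ} A(a) + a^ρ E(a) + a^{2ρ} D(a) ≤ c` (all `a > 0`) is
trivial — OPEN on `0 < ρ ≤ 1/2` (⊇ the Chae–Shvydkoy window for self-similar collapse).  The line `birth`:
`stub_largeRho` (landed) → `stub_backwardVanishing` (landed, ns-typeII-p2) → `stub_noCollapseFromZero`
(OPEN core).  This file closes the lead's successor target #1: an IN-WINDOW rung of the open core that uses
the local-energy-flux lever QUANTITATIVELY —

* `windowFlux_integrableOn_of_gauge` — for a member with `2/5 < ρ`, the weighted Euler flux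
  `(|u|³ + 2|p||u|)/max(1,|x|)` is integrable on every finite window `(α,β) × ℝ³` (`α < β < 0`): dyadic shells
  `a₀2ʲ ≤ |x| < a₀2^{j+1}` (`a₀ = max(1, √(−α))`), the one-ball bound of `…WindowFluxBounds.lean`
  (`∫∫ (|u|³+2|p||u|) ≤ K₃ a^{3/2−9ρ/4} + K₄ a^{11/6−25ρ/12}` from slice-wise Sobolev interpolation, the
  `A`-, `E`-, `D`-gauges and Hölder), and the geometric series with ratios `2^{1/2−9ρ/4}`, `2^{5/6−25ρ/12}`
  (both `< 1` iff `ρ > 2/5`);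
* `powerGaugeEulerLiouville_fromRest` — **«NO EULER COLLAPSE FROM REST»: for `2/5 < ρ`, a member of the class
  that is at rest before some time (`u(t,·) = 0` for `t < −T`) is identically zero** — the crux VERBATIM plus
  the one hypothesis of rest, UNCONDITIONAL (composes `powerGaugeEulerLiouville_fromRest_of_windowFlux`:
  stub 2 + the no-energy-creation/flux stratum `…Flux.lean` + the window flux bound above).

Why it matters for the line: `2/5 < ρ ≤ 1/2` lies INSIDE the open window; the rung says a power-gauged
Euler collapse cannot be spontaneously generated from the zero flow in finite time — it must have an infinite
past (as self-similar/DSS profiles do).  WHAT THIS IS NOT: not NS regularity, not the open core (which allows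
an infinite past); a kernel-checked in-window rung `--supports` stmt-19832. [folklore]
-/

noncomputable section

set_option linter.dupNamespace false

open MeasureTheory Set Filter Topology Metric Function TopologicalSpace Module
open scoped ENNReal NNReal

namespace Summit.NavierStokesRegularity.NavierStokesRegularity.Theorems.PowerGaugeEulerLiouville

open Literature.Analysis Literature.Analysis.FunctionSpaces Literature.Analysis.FluidPDE

/-! ## Dyadic bookkeeping -/

/-- `(a₀ 2ʲ)⁻¹ (a₀ 2^{j+1})^s = 2^s a₀^{s−1} (2^{s−1})ʲ` for `a₀ > 0`. [folklore] -/
theorem dyadic_rpow_identity {a₀ : ℝ} (ha₀ : 0 < a₀) (s : ℝ) (j : ℕ) :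
    (a₀ * 2 ^ j)⁻¹ * (a₀ * 2 ^ (j + 1)) ^ s = 2 ^ s * a₀ ^ (s - 1) * (2 ^ (s - 1)) ^ j := by
  have h2 : (0 : ℝ) < 2 := two_pos
  have h2j : (0 : ℝ) < 2 ^ j := pow_pos h2 j
  rw [Real.mul_rpow ha₀.le (by positivity), pow_succ, Real.mul_rpow h2j.le h2.le,
    ← Real.rpow_natCast (2 : ℝ) j, ← Real.rpow_mul h2.le, ← Real.rpow_natCast ((2 : ℝ) ^ (s - 1)) j,
    ← Real.rpow_mul h2.le, Real.rpow_sub_one ha₀.ne', mul_inv]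
  rw [show (s - 1) * (j : ℝ) = (j : ℝ) * s - (j : ℝ) by ring, Real.rpow_sub h2, Real.rpow_natCast]
  field_simp

/-- A two-ratio geometric series of `ofReal`s is finite. [folklore] -/
theorem tsum_ofReal_geometric_two_lt_top {M₁ M₂ θ₁ θ₂ : ℝ} (hM₁ : 0 ≤ M₁) (hM₂ : 0 ≤ M₂)
    (hθ₁ : 0 ≤ θ₁) (hθ₁' : θ₁ < 1) (hθ₂ : 0 ≤ θ₂) (hθ₂' : θ₂ < 1) :
    (∑' j : ℕ, ENNReal.ofReal (M₁ * θ₁ ^ j + M₂ * θ₂ ^ j)) < ⊤ := by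
  have hsplit : ∀ j : ℕ, ENNReal.ofReal (M₁ * θ₁ ^ j + M₂ * θ₂ ^ j) =
      ENNReal.ofReal M₁ * ENNReal.ofReal θ₁ ^ j + ENNReal.ofReal M₂ * ENNReal.ofReal θ₂ ^ j := by
    intro j
    rw [ENNReal.ofReal_add (by positivity) (by positivity), ENNReal.ofReal_mul hM₁, ENNReal.ofReal_mul hM₂,
      ENNReal.ofReal_pow hθ₁, ENNReal.ofReal_pow hθ₂]
  simp_rw [hsplit]
  rw [ENNReal.tsum_add, ENNReal.tsum_mul_left, ENNReal.tsum_mul_left, ENNReal.tsum_geometric,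
    ENNReal.tsum_geometric]
  have hg : ∀ θ : ℝ, θ < 1 → (1 - ENNReal.ofReal θ)⁻¹ < ⊤ := by
    intro θ hθ
    rw [ENNReal.inv_lt_top, tsub_pos_iff_lt]
    exact ENNReal.ofReal_lt_one.2 hθ
  exact ENNReal.add_lt_top.2 ⟨ENNReal.mul_lt_top ENNReal.ofReal_lt_top (hg θ₁ hθ₁'),
    ENNReal.mul_lt_top ENNReal.ofReal_lt_top (hg θ₂ hθ₂')⟩

/-! ## Window flux integrability for `2/5 < ρ` -/

/-- **The weighted Euler flux of a member is integrable on finite windows when `2/5 < ρ`.**  For a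
member of Seregin's power-gauged class with `2/5 < ρ` and every window `α < β < 0`:
`∫_{(α,β)×ℝ³} (|u|³ + 2|p||u|)/max(1,|x|) < ∞` — dyadic shells `a₀2ʲ ≤ |x| < a₀2^{j+1}` (`a₀ ≥ 1`,
`a₀² ≥ −α`), the one-ball bound `exists_lintegral_cube_add_pressure_window_le` and the geometric series with
ratios `2^{1/2 − 9ρ/4}` and `2^{5/6 − 25ρ/12}` (both `< 1` iff `ρ > 2/5`). [folklore] -/
theorem windowFlux_integrableOn_of_gauge {ρ : ℝ} (hρ : 2 / 5 < ρ)
    {u : ℝ → EuclideanSpace ℝ (Fin 3) → EuclideanSpace ℝ (Fin 3)} {p : ℝ → EuclideanSpace ℝ (Fin 3) → ℝ}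
    {H : ℝ → EuclideanSpace ℝ (Fin 3) → EuclideanSpace ℝ (Fin 3) →L[ℝ] EuclideanSpace ℝ (Fin 3)} {c : ℝ≥0}
    (hsw : IsSuitableWeakSolutionOn (slab (EuclideanSpace ℝ (Fin 3)) (Iio 0) isOpen_Iio) 0 0 u p)
    (hH : HasWeakSpatialGradientOn (slab (EuclideanSpace ℝ (Fin 3)) (Iio 0) isOpen_Iio) u H)
    (hc : ∀ a : ℝ, 0 < a → ENNReal.ofReal (a ^ (2 * ρ)) * cknA a (0 : ℝ × EuclideanSpace ℝ (Fin 3)) u +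
        ENNReal.ofReal (a ^ ρ) * cknE a (0 : ℝ × EuclideanSpace ℝ (Fin 3)) H +
        ENNReal.ofReal (a ^ (2 * ρ)) * cknD a (0 : ℝ × EuclideanSpace ℝ (Fin 3)) p ≤ (c : ℝ≥0∞))
    {α β : ℝ} (hαβ : α < β) (hβ : β < 0) :
    IntegrableOn
      (fun z : ℝ × EuclideanSpace ℝ (Fin 3) => (‖u z.1 z.2‖ ^ 3 + 2 * |p z.1 z.2| * ‖u z.1 z.2‖) / max 1 ‖z.2‖)
      (Ioo α β ×ˢ (univ : Set (EuclideanSpace ℝ (Fin 3)))) volume := by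
  obtain ⟨K, hK0, hK⟩ := exists_lintegral_cube_add_pressure_window_le
  have hρ0 : 0 ≤ ρ := by linarith
  set W : Set ℝ := Ioo α β with hW
  have hWs : W ⊆ Iio 0 := fun s hs => lt_trans hs.2 hβ
  -- measurability on the slab
  have hum : AEStronglyMeasurable (uncurry u)
      (volume.restrict (Iio (0 : ℝ) ×ˢ (univ : Set (EuclideanSpace ℝ (Fin 3))))) := by
    have := hH.locallyIntegrableOn.aestronglyMeasurable
    simpa [slab] using this
  have hpm : AEStronglyMeasurable (uncurry p)
      (volume.restrict (Iio (0 : ℝ) ×ˢ (univ : Set (EuclideanSpace ℝ (Fin 3))))) := by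
    have := hsw.distributional.2.2.1.aestronglyMeasurable
    simpa [slab] using this
  set μ : Measure (ℝ × EuclideanSpace ℝ (Fin 3)) := volume.restrict (W ×ˢ (univ : Set (EuclideanSpace ℝ (Fin 3)))) with hμ
  have hum' : AEStronglyMeasurable (uncurry u) μ := hum.mono_measure (Measure.restrict_mono (prod_mono hWs Subset.rfl) le_rfl)
  have hpm' : AEStronglyMeasurable (uncurry p) μ := hpm.mono_measure (Measure.restrict_mono (prod_mono hWs Subset.rfl) le_rfl)
  set G : ℝ × EuclideanSpace ℝ (Fin 3) → ℝ :=
    fun z => (‖u z.1 z.2‖ ^ 3 + 2 * |p z.1 z.2| * ‖u z.1 z.2‖) / max 1 ‖z.2‖ with hG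
  have hwcont : Continuous fun z : ℝ × EuclideanSpace ℝ (Fin 3) => (max 1 ‖z.2‖)⁻¹ :=
    Continuous.inv₀ (continuous_const.max continuous_snd.norm) fun z => (lt_of_lt_of_le one_pos (le_max_left _ _)).ne'
  have hGm : AEStronglyMeasurable G μ := by
    have h1 : AEStronglyMeasurable (fun z : ℝ × EuclideanSpace ℝ (Fin 3) =>
        (‖uncurry u z‖ ^ 3 + 2 * |uncurry p z| * ‖uncurry u z‖) * (max 1 ‖z.2‖)⁻¹) μ :=
      ((hum'.norm.pow 3).add ((hpm'.norm.const_mul 2).mul hum'.norm)).mul hwcont.aestronglyMeasurable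
    refine h1.congr (Eventually.of_forall fun z => ?_)
    simp only [hG, uncurry, div_eq_mul_inv]
  refine ⟨hGm, ?_⟩
  -- the `ℝ≥0∞` density `Ψ ≥ ‖G‖ₑ`
  set Ψ : ℝ × EuclideanSpace ℝ (Fin 3) → ℝ≥0∞ := fun z =>
    (‖u z.1 z.2‖ₑ ^ (3 : ℕ) + 2 * (‖p z.1 z.2‖ₑ * ‖u z.1 z.2‖ₑ)) * (ENNReal.ofReal (max 1 ‖z.2‖))⁻¹ with hΨ
  have hGΨ : ∀ z, ‖G z‖ₑ ≤ Ψ z := by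
    intro z
    have hm : 0 < max 1 ‖z.2‖ := lt_of_lt_of_le one_pos (le_max_left _ _)
    have hG0 : 0 ≤ G z := by simp only [hG]; positivity
    rw [Real.enorm_eq_ofReal hG0, hG, ENNReal.ofReal_div_of_pos hm, div_eq_mul_inv]
    refine mul_le_mul' (le_of_eq ?_) le_rfl
    have e1 : ENNReal.ofReal (‖u z.1 z.2‖ ^ 3) = ‖u z.1 z.2‖ₑ ^ (3 : ℕ) := by
      rw [ENNReal.ofReal_pow (norm_nonneg _), ofReal_norm]
    have e2 : ENNReal.ofReal (2 * |p z.1 z.2| * ‖u z.1 z.2‖) = 2 * (‖p z.1 z.2‖ₑ * ‖u z.1 z.2‖ₑ) := by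
      rw [mul_assoc, ENNReal.ofReal_mul (by norm_num : (0 : ℝ) ≤ 2), ENNReal.ofReal_ofNat,
        ENNReal.ofReal_mul (abs_nonneg _), ← Real.norm_eq_abs, ofReal_norm, ofReal_norm]
    rw [ENNReal.ofReal_add (by positivity) (by positivity), e1, e2]
  -- dyadic radii
  have hα0 : 0 < -α := by linarith
  set a₀ : ℝ := max 1 (Real.sqrt (-α)) with ha₀
  have ha₀1 : 1 ≤ a₀ := le_max_left _ _
  have ha₀0 : 0 < a₀ := lt_of_lt_of_le one_pos ha₀1
  have ha₀α : -(a₀ ^ 2) ≤ α := by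
    have h1 : Real.sqrt (-α) ≤ a₀ := le_max_right _ _
    have h2 : Real.sqrt (-α) ^ 2 = -α := Real.sq_sqrt hα0.le
    nlinarith [Real.sqrt_nonneg (-α)]
  set R : ℕ → ℝ := fun j => a₀ * 2 ^ j with hR
  have hR1 : ∀ j, 1 ≤ R j := fun j => by
    simp only [hR]; exact le_trans ha₀1 (le_mul_of_one_le_right ha₀0.le (one_le_pow₀ (by norm_num)))
  have hR0 : ∀ j, 0 < R j := fun j => lt_of_lt_of_le one_pos (hR1 j)
  have hRα : ∀ j, -(R j ^ 2) ≤ α := fun j => by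
    have : a₀ ^ 2 ≤ R j ^ 2 := by
      have h1 : a₀ ≤ R j := by simp only [hR]; exact le_mul_of_one_le_right ha₀0.le (one_le_pow₀ (by norm_num))
      nlinarith
    linarith
  have hRmono : ∀ j, R j ≤ R (j + 1) := fun j => by
    simp only [hR, pow_succ]; nlinarith [pow_pos (two_pos : (0:ℝ) < 2) j]
  -- the one-ball masses
  set N : ℕ → ℝ≥0∞ := fun j => ∫⁻ z in W ×ˢ ball (0 : EuclideanSpace ℝ (Fin 3)) (R j),
    (‖u z.1 z.2‖ₑ ^ (3 : ℕ) + 2 * (‖p z.1 z.2‖ₑ * ‖u z.1 z.2‖ₑ)) with hN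
  set s₁ : ℝ := 3 / 2 - 9 * ρ / 4 with hs₁
  set s₂ : ℝ := 11 / 6 - 25 * ρ / 12 with hs₂
  set K₃ : ℝ := K * (c : ℝ) ^ (3 / 2 : ℝ) * ((β - α) ^ (1 / 4 : ℝ) + (β - α)) with hK₃
  set K₄ : ℝ := 2 * ((c : ℝ) ^ (2 / 3 : ℝ) * K₃ ^ (1 / 3 : ℝ)) with hK₄
  have hL : 0 < β - α := by linarith
  have hK₃0 : 0 ≤ K₃ := by positivity
  have hK₄0 : 0 ≤ K₄ := by positivity
  have hNle : ∀ j, N j ≤ ENNReal.ofReal (K₃ * R j ^ s₁ + K₄ * R j ^ s₂) := fun j =>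
    hK ρ hρ0 u p H c hsw hH hc (R j) α β (hR1 j) (hRα j) hαβ hβ.le
  -- shells
  set D : ℕ → Set (EuclideanSpace ℝ (Fin 3)) := fun j =>
    Nat.casesOn j (ball (0 : EuclideanSpace ℝ (Fin 3)) (R 0))
      (fun i => ball (0 : EuclideanSpace ℝ (Fin 3)) (R (i + 1)) \ ball (0 : EuclideanSpace ℝ (Fin 3)) (R i)) with hD
  have hDU : (⋃ j, W ×ˢ D j) = W ×ˢ (univ : Set (EuclideanSpace ℝ (Fin 3))) := by
    rw [← prod_iUnion]
    congr 1
    refine eq_univ_of_forall fun x => mem_iUnion.2 ?_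
    -- the least `j` with `‖x‖ < R j`
    have hex : ∃ j : ℕ, ‖x‖ < R j := by
      obtain ⟨n, hn⟩ := pow_unbounded_of_one_lt ‖x‖ (by norm_num : (1 : ℝ) < 2)
      refine ⟨n, lt_of_lt_of_le hn ?_⟩
      simp only [hR]; exact le_mul_of_one_le_left (by positivity) ha₀1
    classical
    refine ⟨Nat.find hex, ?_⟩
    rcases h : Nat.find hex with _ | i
    · have := Nat.find_spec hex; rw [h] at this; exact mem_ball_zero_iff.2 this
    · have h1 := Nat.find_spec hex; rw [h] at h1
      have h2 := Nat.find_min hex (show i < Nat.find hex by omega)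
      exact ⟨mem_ball_zero_iff.2 h1, fun hx => h2 (mem_ball_zero_iff.1 hx)⟩
  -- shell estimates
  have hshell0 : ∫⁻ z in W ×ˢ D 0, Ψ z ≤ N 0 := by
    refine lintegral_mono fun z => ?_
    simp only [hΨ]
    refine mul_le_of_le_one_right' ?_
    rw [ENNReal.inv_le_one]
    exact ENNReal.one_le_ofReal.2 (le_max_left _ _)
  have hshell : ∀ i : ℕ, ∫⁻ z in W ×ˢ D (i + 1), Ψ z ≤ (ENNReal.ofReal (R i))⁻¹ * N (i + 1) := by
    intro i
    have hsub : W ×ˢ D (i + 1) ⊆ W ×ˢ ball (0 : EuclideanSpace ℝ (Fin 3)) (R (i + 1)) :=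
      prod_mono Subset.rfl sdiff_subset
    calc ∫⁻ z in W ×ˢ D (i + 1), Ψ z
        ≤ ∫⁻ z in W ×ˢ D (i + 1), (ENNReal.ofReal (R i))⁻¹ *
            (‖u z.1 z.2‖ₑ ^ (3 : ℕ) + 2 * (‖p z.1 z.2‖ₑ * ‖u z.1 z.2‖ₑ)) := by
          refine setLIntegral_mono' (measurableSet_Ioo.prod (measurableSet_ball.diff measurableSet_ball)) fun z hz => ?_
          simp only [hΨ]
          rw [mul_comm]
          refine mul_le_mul' ?_ le_rfl
          rw [ENNReal.inv_le_inv]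
          refine ENNReal.ofReal_le_ofReal (le_trans ?_ (le_max_right _ _))
          have := hz.2.2
          rw [mem_ball_zero_iff, not_lt] at this
          exact this
      _ = (ENNReal.ofReal (R i))⁻¹ * ∫⁻ z in W ×ˢ D (i + 1), (‖u z.1 z.2‖ₑ ^ (3 : ℕ) + 2 * (‖p z.1 z.2‖ₑ * ‖u z.1 z.2‖ₑ)) :=
          lintegral_const_mul' _ _ (ENNReal.inv_ne_top.2 ((ENNReal.ofReal_pos.2 (hR0 i)).ne'))
      _ ≤ (ENNReal.ofReal (R i))⁻¹ * N (i + 1) := mul_le_mul' le_rfl (lintegral_mono_set hsub)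
  -- the dyadic terms are a two-ratio geometric sequence
  set θ₁ : ℝ := (2 : ℝ) ^ (s₁ - 1) with hθ₁
  set θ₂ : ℝ := (2 : ℝ) ^ (s₂ - 1) with hθ₂
  have hθ₁1 : θ₁ < 1 := Real.rpow_lt_one_of_one_lt_of_neg (by norm_num) (by rw [hs₁]; linarith)
  have hθ₂1 : θ₂ < 1 := Real.rpow_lt_one_of_one_lt_of_neg (by norm_num) (by rw [hs₂]; linarith)
  have hθ₁0 : 0 ≤ θ₁ := by positivity
  have hθ₂0 : 0 ≤ θ₂ := by positivity
  set M₁ : ℝ := K₃ * (2 ^ s₁ * a₀ ^ (s₁ - 1)) with hM₁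
  set M₂ : ℝ := K₄ * (2 ^ s₂ * a₀ ^ (s₂ - 1)) with hM₂
  have hterm : ∀ i : ℕ, (ENNReal.ofReal (R i))⁻¹ * N (i + 1) ≤ ENNReal.ofReal (M₁ * θ₁ ^ i + M₂ * θ₂ ^ i) := by
    intro i
    calc (ENNReal.ofReal (R i))⁻¹ * N (i + 1)
        ≤ (ENNReal.ofReal (R i))⁻¹ * ENNReal.ofReal (K₃ * R (i + 1) ^ s₁ + K₄ * R (i + 1) ^ s₂) :=
          mul_le_mul' le_rfl (hNle (i + 1))
      _ = ENNReal.ofReal ((R i)⁻¹ * (K₃ * R (i + 1) ^ s₁ + K₄ * R (i + 1) ^ s₂)) := by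
          rw [← ENNReal.ofReal_inv_of_pos (hR0 i), ← ENNReal.ofReal_mul (inv_nonneg.2 (hR0 i).le)]
      _ = ENNReal.ofReal (M₁ * θ₁ ^ i + M₂ * θ₂ ^ i) := by
          congr 1
          have e1 := dyadic_rpow_identity ha₀0 s₁ i
          have e2 := dyadic_rpow_identity ha₀0 s₂ i
          simp only [hR, hM₁, hM₂, hθ₁, hθ₂] at e1 e2 ⊢
          calc (a₀ * 2 ^ i)⁻¹ * (K₃ * (a₀ * 2 ^ (i + 1)) ^ s₁ + K₄ * (a₀ * 2 ^ (i + 1)) ^ s₂)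
              = K₃ * ((a₀ * 2 ^ i)⁻¹ * (a₀ * 2 ^ (i + 1)) ^ s₁) + K₄ * ((a₀ * 2 ^ i)⁻¹ * (a₀ * 2 ^ (i + 1)) ^ s₂) := by ring
            _ = K₃ * (2 ^ s₁ * a₀ ^ (s₁ - 1)) * (2 ^ (s₁ - 1)) ^ i + K₄ * (2 ^ s₂ * a₀ ^ (s₂ - 1)) * (2 ^ (s₂ - 1)) ^ i := by
                rw [e1, e2]; ring
  -- summing up
  have htot : ∫⁻ z in W ×ˢ (univ : Set (EuclideanSpace ℝ (Fin 3))), Ψ z < ⊤ := by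
    have h1 : ∫⁻ z in W ×ˢ (univ : Set (EuclideanSpace ℝ (Fin 3))), Ψ z ≤ ∑' j, ∫⁻ z in W ×ˢ D j, Ψ z := by
      rw [← hDU]; exact lintegral_iUnion_le _ _
    have h2 : (∑' j, ∫⁻ z in W ×ˢ D j, Ψ z) = (∫⁻ z in W ×ˢ D 0, Ψ z) + ∑' i, ∫⁻ z in W ×ˢ D (i + 1), Ψ z :=
      tsum_eq_zero_add' ENNReal.summable
    have h3 : (∑' i, ∫⁻ z in W ×ˢ D (i + 1), Ψ z) ≤ ∑' i, ENNReal.ofReal (M₁ * θ₁ ^ i + M₂ * θ₂ ^ i) :=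
      ENNReal.tsum_le_tsum fun i => (hshell i).trans (hterm i)
    have h4 := tsum_ofReal_geometric_two_lt_top (by positivity : 0 ≤ M₁) (by positivity : 0 ≤ M₂) hθ₁0 hθ₁1 hθ₂0 hθ₂1
    have h5 : N 0 < ⊤ := lt_of_le_of_lt (hNle 0) ENNReal.ofReal_lt_top
    calc ∫⁻ z in W ×ˢ (univ : Set (EuclideanSpace ℝ (Fin 3))), Ψ z
        ≤ (∫⁻ z in W ×ˢ D 0, Ψ z) + ∑' i, ∫⁻ z in W ×ˢ D (i + 1), Ψ z := h1.trans (le_of_eq h2)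
      _ < ⊤ := ENNReal.add_lt_top.2 ⟨lt_of_le_of_lt hshell0 h5, lt_of_le_of_lt h3 h4⟩
  -- conclusion
  rw [hasFiniteIntegral_iff_enorm]
  exact lt_of_le_of_lt (lintegral_mono fun z => hGΨ z) htot

/-- **«NO EULER COLLAPSE FROM REST» in Seregin's power-gauged class, unconditionally for `2/5 < ρ`.**
A suitable weak Euler flow on `(−∞,0) × ℝ³` in the class `a^{2ρ} A(a) + a^ρ E(a) + a^{2ρ} D(a) ≤ c` (all
`a > 0`) with `2/5 < ρ` which is AT REST before some time (`u(t,·) = 0` for `t < −T`) is identically zero: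
the crux `PowerGaugeEulerLiouville` VERBATIM plus the one hypothesis of rest.  An in-window rung
(`2/5 < ρ ≤ 1/2` is inside the open window) that USES the local energy inequality quantitatively: stub 2
(backward vanishing, ns-typeII-p2) + no energy creation (lead, `…Flux.lean`) + the window flux bound from the
gauges (`windowFlux_integrableOn_of_gauge`). [folklore] -/
theorem powerGaugeEulerLiouville_fromRest :
    ∀ ρ : ℝ, 2 / 5 < ρ → ∀ (u : ℝ → EuclideanSpace ℝ (Fin 3) → EuclideanSpace ℝ (Fin 3))
      (p : ℝ → EuclideanSpace ℝ (Fin 3) → ℝ)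
      (H : ℝ → EuclideanSpace ℝ (Fin 3) → EuclideanSpace ℝ (Fin 3) →L[ℝ] EuclideanSpace ℝ (Fin 3)) (c : ℝ≥0),
      IsSuitableWeakSolutionOn (slab (EuclideanSpace ℝ (Fin 3)) (Set.Iio 0) isOpen_Iio) 0 0 u p →
      HasWeakSpatialGradientOn (slab (EuclideanSpace ℝ (Fin 3)) (Set.Iio 0) isOpen_Iio) u H →
      (∀ a : ℝ, 0 < a → ENNReal.ofReal (a ^ (2 * ρ)) * cknA a (0 : ℝ × EuclideanSpace ℝ (Fin 3)) u +
        ENNReal.ofReal (a ^ ρ) * cknE a (0 : ℝ × EuclideanSpace ℝ (Fin 3)) H +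
        ENNReal.ofReal (a ^ (2 * ρ)) * cknD a (0 : ℝ × EuclideanSpace ℝ (Fin 3)) p ≤ (c : ℝ≥0∞)) →
      (∃ T : ℝ, ∀ t : ℝ, t < -T → ∀ x : EuclideanSpace ℝ (Fin 3), u t x = 0) →
      Function.uncurry u =ᵐ[volume.restrict (Set.Iio (0 : ℝ) ×ˢ (Set.univ : Set (EuclideanSpace ℝ (Fin 3))))] 0 :=
  fun ρ hρ u p H c hsw hH hc hrest =>
    powerGaugeEulerLiouville_fromRest_of_windowFlux ρ (by linarith) u p H c hsw hH hc hrest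
      fun _ _ hab hb => windowFlux_integrableOn_of_gauge hρ hsw hH hc hab hb

end Summit.NavierStokesRegularity.NavierStokesRegularity.Theorems.PowerGaugeEulerLiouville

end
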